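import Summits.QuantumFields.YangMills.Theorems.AlphaInputsT3ACv3RelativeGauge
import Summits.QuantumFields.YangMills.Theorems.UnitScaleTiltProp7AxialGaugeFace
import Literature.MathematicalPhysics.QuantumFieldTheory.Balaban1983to89.B8Ineq129
import HarnessLib

/-!
# `AlphaInputsT3ACv3RelativeGaugeDrift` — STRATEGY B for 2′, the (FL) row under OWNER RULING g24-№4, residual (D-cert) letter `ω`: **THE DRIFT OF THE RELATIVE GAUGE ALONG THE COMB
# INSIDE A PRODUCT SET** — two gauges flattening the same field on a coordinate box differ there by a rotation that varies by at most `(η₁ + η₂)·|Γ_{y,x}|` between the anchor `y`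
# and any `x` whose comb from `y` stays in the box; hence the oscillation letter `ω` of `NewtonLiftFramed.hRinv_of_gaugeFrames` is `≤ (η_c + η_{c′})·(|Γ| + |Γ′|)` from FLATNESS ALONE
# — lane `pub-balaban3d` ∕ cell `ym3-torus`, seat `ym-ust-19936-w4` (g2)

WHY (cell `ym3-torus` 2026-08-28: this seat's PROGRESS 5 «(D-cert) at `obLift` = scalar (E)∕(B)∕(C) + ONE displayed number ω = the drift of `σ_cσ_{c′}⁻¹` inside one block — the block-walk
existence is the only geometric letter left»; ★alpha-2 g6 (r1-ob): the one-block kernel reads `b` and the centre `toFine k c′₋` in ONE block, where both stencil gauges are flat).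
This seat's g0 file `…RelativeGauge` proved the drift bound along an ABSTRACT walk (`norm_relGauge_walkEnd_sub_le`) from flatness ON THE WALK'S BONDS.  THIS FILE supplies the walk:
Bałaban's comb `Γ_{y,x}` (`treeWord (rel y x)`, ★p1's `walkEnd_treeWord_rel`), whose prefix positions stay in the coordinate box spanned by `y` and `x` (`B8Ineq129.disp_prefix_treeWord_mem`),
so flatness on a PRODUCT SET of sites containing that box suffices:
* §1 `walk_bond_mem_of_prefix_mem` (every traversed bond has both endpoints among the prefix positions), `walkEnd_take_treeWord_mem_pi` (the comb's prefix positions lie in any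
  product set containing the coordinate box — ★w1 g0's `walkEnd_take_combLoop_mem_pi` pattern for the open comb).
* §2 ★★ `norm_relGauge_comb_sub_le_pi` — `‖t(x) − t(y)‖ ≤ (η₁ + η₂)·|rel y x|₁` for `t = g₁g₂⁻¹` when `U^{g₁}, U^{g₂}` are `η₁, η₂`-flat on the bonds of the product set and the box
  `[y ⊓ x, y ⊔ x]` lies in it; ★★ `norm_relGauge_sub_relGauge_le_pi` — two points: `‖t(x₁) − t(x₂)‖ ≤ (η₁ + η₂)·(|rel y x₁|₁ + |rel y x₂|₁)` — the `ω` of `hRinv_of_gaugeFrames`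
  with `y` the block centre (`|rel|₁ ≤ d·⌊L^k∕2⌋`): `ω ≤ (η_c + η_{c′})·d·L^k = O(ε′)`, k-UNIFORM.
HONEST FRAMING.  Lattice-walk bookkeeping; which product set is the block ∕ the two-block and that the centre's box stays inside is the START's chart ((S5)∕(r1-σ)), displayed here as the
binder `hbox` exactly as in `RegionAxialGauge.walkEnd_take_combLoop_mem_pi`; (FL)∕`hLift`, the stub 2′χ, the crux and any gap are NOT claimed; count-neutral helper toward R3 2′ (items
19936∕19935); registry untouched; nothing about d = 4, the continuum, or a mass gap; YM₃ on T³ is rung R3, not Clay.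

References: T. Bałaban, Commun. Math. Phys. 98 (1985) 17–51 [Balaban1985Averaging] ((8) p.18, (19) p.21, pp.24–25); Commun. Math. Phys. 95 (1984) 17–40 [Balaban1984PropagatorsI]
((1.7) p.18: the comb `Γ_{y,x}`).
-/

set_option autoImplicit false

noncomputable section

open scoped Matrix.Norms.L2Operator
namespace Summit.QuantumFields.YangMills.Theorems.NewtonLiftFramed

open Literature.MathematicalPhysics.QuantumFieldTheory.Balaban1983to89
open T4Continuum
open B10Eq27TorusAxialLog (rel rel_apply)
open B7Prop1Explicit (treeWord l1 disp disp_treeWord length_treeWord)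
open B8Ineq129 (disp_prefix_treeWord_mem)
open Summit.QuantumFields.YangMills.Theorems.Prop7AxialGaugeFace (disp_apply_eq_netDisp walkEnd_treeWord_rel)
open Summit.QuantumFields.YangMills.Theorems.RelativeGauge (norm_relGauge_walkEnd_sub_le)

variable {P : Params} {j : ℕ}

/-! ## §1 Walk bookkeeping: traversed bonds and the comb's prefix positions -/

/-- **EVERY TRAVERSED BOND HAS BOTH ENDPOINTS AMONG THE PREFIX POSITIONS**: if all prefix positions `walkEnd y (w.take k)`, `k ≤ |w|`, lie in a set `S`, every step of `walk y w` has its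
bond's source and target in `S`. [folklore] -/
theorem walk_bond_mem_of_prefix_mem (S : Set (Site P j)) : ∀ (y : Site P j) (w : List (Letter P.d)),
    (∀ k, k ≤ w.length → walkEnd y (w.take k) ∈ S) → ∀ s ∈ walk y w, s.bond.src ∈ S ∧ s.bond.tgt ∈ S
  | y, [], _, s, hs => by simp [walk] at hs
  | y, (μ, true) :: w, h, s, hs => by
    have h0 : y ∈ S := by simpa [walkEnd] using h 0 (Nat.zero_le _)
    have h' : ∀ k, k ≤ w.length → walkEnd (y.shift μ) (w.take k) ∈ S := fun k hk => by
      have := h (k + 1) (by simp only [List.length_cons]; omega)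
      simpa [List.take_succ_cons, walkEnd] using this
    rw [walk] at hs
    rcases List.mem_cons.1 hs with rfl | hs'
    · refine ⟨h0, ?_⟩
      have h1 := h' 0 (Nat.zero_le _)
      simpa [walkEnd, PBond.tgt] using h1
    · exact walk_bond_mem_of_prefix_mem S (y.shift μ) w h' s hs'
  | y, (μ, false) :: w, h, s, hs => by
    have h0 : y ∈ S := by simpa [walkEnd] using h 0 (Nat.zero_le _)
    have h' : ∀ k, k ≤ w.length → walkEnd (y.unshift μ) (w.take k) ∈ S := fun k hk => by
      have := h (k + 1) (by simp only [List.length_cons]; omega)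
      simpa [List.take_succ_cons, walkEnd] using this
    have hus : (y.unshift μ).shift μ = y := by
      funext ν
      by_cases hν : ν = μ
      · subst hν; simp
      · simp [Site.shift_apply, Site.unshift_apply, hν]
    rw [walk] at hs
    rcases List.mem_cons.1 hs with rfl | hs'
    · refine ⟨?_, ?_⟩
      · have h1 := h' 0 (Nat.zero_le _)
        simpa [walkEnd] using h1
      · show (y.unshift μ).shift μ ∈ S
        rw [hus]; exact h0
    · exact walk_bond_mem_of_prefix_mem S (y.unshift μ) w h' s hs'

/-- **THE COMB'S PREFIX POSITIONS LIE IN ANY PRODUCT SET CONTAINING ITS COORDINATE BOX**: for the comb word `treeWord v` from `y` and a product set `{z | ∀ κ, z κ ∈ I κ}` containing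
`y + t·e_κ`-wise the box `[0 ⊓ v κ, 0 ⊔ v κ]`, every prefix position lies in the product set (`B8Ineq129.disp_prefix_treeWord_mem`; ★w1 g0's comb-loop pattern for the open comb).
[cite: Balaban1985Averaging, p.24; Balaban1984PropagatorsI, (1.7) p.18] -/
theorem walkEnd_take_treeWord_mem_pi {I : Fin P.d → Set (ZMod (P.sitesPerDir j))} (y : Site P j) (v : B7Prop1Explicit.Site P.d)
    (hbox : ∀ (κ : Fin P.d) (t : ℤ), min 0 (v κ) ≤ t → t ≤ max 0 (v κ) → y κ + ((t : ℤ) : ZMod (P.sitesPerDir j)) ∈ I κ) (k : ℕ) :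
    walkEnd y ((treeWord v).take k) ∈ {z : Site P j | ∀ κ, z κ ∈ I κ} := by
  intro κ
  rw [walkEnd_apply, ← disp_apply_eq_netDisp]
  obtain ⟨h1, h2⟩ := disp_prefix_treeWord_mem v (List.take_append_drop k (treeWord v)).symm κ
  exact hbox κ _ h1 h2

/-! ## §2 The drift of the relative gauge along the comb -/

variable {n : Type*} [Fintype n] [DecidableEq n] [Nonempty n]

/-- **★★ THE COMB DRIFT OF THE RELATIVE GAUGE INSIDE A PRODUCT SET**: `S = {z | ∀ κ, z κ ∈ I κ}`; two gauges `g₁, g₂` with `U^{g₁}`, `U^{g₂}` `η₁`-, `η₂`-flat on every bond with both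
endpoints in `S`; a site `x` whose coordinate box from `y` lies in `S` (`hbox`, as in `RegionAxialGauge.walkEnd_take_combLoop_mem_pi`).  Then the relative gauge `t = g₁g₂⁻¹` satisfies
`‖t(x) − t(y)‖ ≤ (η₁ + η₂)·|rel y x|₁` (g0's `norm_relGauge_walkEnd_sub_le` along the comb `Γ_{y,x}`, which ends at `x` by ★p1's `walkEnd_treeWord_rel` and has `|rel y x|₁` bonds).
[cite: Balaban1985Averaging, (8) p.18, (19) p.21, p.24] -/
theorem norm_relGauge_comb_sub_le_pi (g₁ g₂ : GaugeTransf P j (Matrix.specialUnitaryGroup n ℂ)) (U : GaugeField P j (Matrix.specialUnitaryGroup n ℂ))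
    {I : Fin P.d → Set (ZMod (P.sitesPerDir j))} {η₁ η₂ : ℝ}
    (h₁ : ∀ b : PBond P j, b.src ∈ {z : Site P j | ∀ κ, z κ ∈ I κ} → b.tgt ∈ {z : Site P j | ∀ κ, z κ ∈ I κ} →
      ‖((GaugeField.gaugeAct g₁ U b : Matrix.specialUnitaryGroup n ℂ) : Matrix n n ℂ) - 1‖ ≤ η₁)
    (h₂ : ∀ b : PBond P j, b.src ∈ {z : Site P j | ∀ κ, z κ ∈ I κ} → b.tgt ∈ {z : Site P j | ∀ κ, z κ ∈ I κ} →
      ‖((GaugeField.gaugeAct g₂ U b : Matrix.specialUnitaryGroup n ℂ) : Matrix n n ℂ) - 1‖ ≤ η₂)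
    (y x : Site P j) (hbox : ∀ (κ : Fin P.d) (t : ℤ), min 0 (rel y x κ) ≤ t → t ≤ max 0 (rel y x κ) → y κ + ((t : ℤ) : ZMod (P.sitesPerDir j)) ∈ I κ) :
    ‖((g₁ x * (g₂ x)⁻¹ : Matrix.specialUnitaryGroup n ℂ) : Matrix n n ℂ) - ((g₁ y * (g₂ y)⁻¹ : Matrix.specialUnitaryGroup n ℂ) : Matrix n n ℂ)‖ ≤ (η₁ + η₂) * (l1 (rel y x) : ℝ) := by
  have hpref : ∀ k, k ≤ (treeWord (rel y x)).length → walkEnd y ((treeWord (rel y x)).take k) ∈ {z : Site P j | ∀ κ, z κ ∈ I κ} :=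
    fun k _ => walkEnd_take_treeWord_mem_pi y (rel y x) hbox k
  have hbonds := walk_bond_mem_of_prefix_mem {z : Site P j | ∀ κ, z κ ∈ I κ} y (treeWord (rel y x)) hpref
  have h := norm_relGauge_walkEnd_sub_le g₁ g₂ U y (treeWord (rel y x)) (fun s hs => h₁ s.bond (hbonds s hs).1 (hbonds s hs).2)
    (fun s hs => h₂ s.bond (hbonds s hs).1 (hbonds s hs).2)
  rwa [walkEnd_treeWord_rel, length_treeWord] at h

/-- **★★ TWO POINTS: THE OSCILLATION OF THE RELATIVE GAUGE ON A PRODUCT SET** — for `x₁, x₂` whose coordinate boxes from the anchor `y` lie in the product set where both gauged fields are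
flat, `‖t(x₁) − t(x₂)‖ ≤ (η₁ + η₂)·(|rel y x₁|₁ + |rel y x₂|₁)`.  With `y` the centre of a `k`-block, `x₁ = b₋` in the block and `x₂ = y`: this is the letter `ω` of
`NewtonLiftFramed.hRinv_of_gaugeFrames` for the one-block kernel, `ω ≤ (η_c + η_{c′})·d·⌊L^k∕2⌋` — k-UNIFORM once `η = O(ε′L^{−k})`. [cite: Balaban1985Averaging, (8) p.18, (19) p.21, pp.24-25] -/
theorem norm_relGauge_sub_relGauge_le_pi (g₁ g₂ : GaugeTransf P j (Matrix.specialUnitaryGroup n ℂ)) (U : GaugeField P j (Matrix.specialUnitaryGroup n ℂ))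
    {I : Fin P.d → Set (ZMod (P.sitesPerDir j))} {η₁ η₂ : ℝ}
    (h₁ : ∀ b : PBond P j, b.src ∈ {z : Site P j | ∀ κ, z κ ∈ I κ} → b.tgt ∈ {z : Site P j | ∀ κ, z κ ∈ I κ} →
      ‖((GaugeField.gaugeAct g₁ U b : Matrix.specialUnitaryGroup n ℂ) : Matrix n n ℂ) - 1‖ ≤ η₁)
    (h₂ : ∀ b : PBond P j, b.src ∈ {z : Site P j | ∀ κ, z κ ∈ I κ} → b.tgt ∈ {z : Site P j | ∀ κ, z κ ∈ I κ} →
      ‖((GaugeField.gaugeAct g₂ U b : Matrix.specialUnitaryGroup n ℂ) : Matrix n n ℂ) - 1‖ ≤ η₂)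
    (y x₁ x₂ : Site P j)
    (hbox₁ : ∀ (κ : Fin P.d) (t : ℤ), min 0 (rel y x₁ κ) ≤ t → t ≤ max 0 (rel y x₁ κ) → y κ + ((t : ℤ) : ZMod (P.sitesPerDir j)) ∈ I κ)
    (hbox₂ : ∀ (κ : Fin P.d) (t : ℤ), min 0 (rel y x₂ κ) ≤ t → t ≤ max 0 (rel y x₂ κ) → y κ + ((t : ℤ) : ZMod (P.sitesPerDir j)) ∈ I κ) :
    ‖((g₁ x₁ * (g₂ x₁)⁻¹ : Matrix.specialUnitaryGroup n ℂ) : Matrix n n ℂ) - ((g₁ x₂ * (g₂ x₂)⁻¹ : Matrix.specialUnitaryGroup n ℂ) : Matrix n n ℂ)‖ ≤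
      (η₁ + η₂) * ((l1 (rel y x₁) : ℝ) + (l1 (rel y x₂) : ℝ)) := by
  have e1 := norm_relGauge_comb_sub_le_pi g₁ g₂ U h₁ h₂ y x₁ hbox₁
  have e2 := norm_relGauge_comb_sub_le_pi g₁ g₂ U h₁ h₂ y x₂ hbox₂
  have tri := norm_sub_le_norm_sub_add_norm_sub ((g₁ x₁ * (g₂ x₁)⁻¹ : Matrix.specialUnitaryGroup n ℂ) : Matrix n n ℂ)
    ((g₁ y * (g₂ y)⁻¹ : Matrix.specialUnitaryGroup n ℂ) : Matrix n n ℂ) ((g₁ x₂ * (g₂ x₂)⁻¹ : Matrix.specialUnitaryGroup n ℂ) : Matrix n n ℂ)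
  rw [norm_sub_rev (((g₁ y * (g₂ y)⁻¹ : Matrix.specialUnitaryGroup n ℂ) : Matrix n n ℂ))] at tri
  nlinarith [tri, e1, e2]

end Summit.QuantumFields.YangMills.Theorems.NewtonLiftFramed

end
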